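import Mathlib
import Summits.NavierStokesRegularity.NavierStokesRegularity.Theorems.EulerZoomLiouvillePowerGaugeEulerLiouvilleSelfSimilarEndpointDecay
import HarnessLib

/-!
# Rung C1 of the crux `EulerZoomLiouville.PowerGaugeEulerLiouville` at the endpoint `ρ = 1/2`:
# shell-energy drain and Chae–Shvydkoy's Theorem 3.1 in the weak (profile) class

Route №10 `EulerZoomLiouville` (NavierStokesRegularity), crux E = stmt-NavierStokesRegularity-19832,
tenure rung C1 (exactly self-similar members) at the energy-conserving endpoint `ρ = 1/2`
(Chae–Shvydkoy `α = N/2`).  PROFILE-LEVEL conclusions for a pair `(V, P)` on `ℝ³` with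
`V ∈ L² ∩ L³_loc`, `|P||V| ∈ L¹_loc`, the forward profile local energy inequality of the class
(`…SelfSimilarLEI` / `…SelfSimilarTransfer`, at `γ = 2/5`), the Riesz representation of `P` at
large scales and the sublinear growth `‖V(y)‖ ≤ C_up |y|^{1−δ}` (`|y| ≥ R₀`, `0 < δ ≤ 1`):

* (prequel `…EndpointDecay`: the drain rate `e(L) ≤ C_ε L^{−5+ε}` of the shell energies
  `e(l) = ∫_{l ≤ |y| < 2l} ‖V‖²`);
* `shell_energy_lower_of_powerLower` — a lower power bound `‖V(y)‖ ≥ c|y|^{−(4−δ')}` gives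
  `e(L) ≳ L^{−5+2δ'}`;
* `profile_liouville_half_of_powerSpread` — **Chae–Shvydkoy's Thm 3.1 in the weak class**: if in
  addition `‖V(y)‖ ≥ c |y|^{−(4−δ')}` for `|y| ≥ R₀'` (`c, δ' > 0`), contradiction (`False`):
  no such profile exists.  The lower bound enters only here (in print it is also used for the
  far-field pressure terms).

WHAT THIS IS NOT: not NS, not E, not rung C1 — the endpoint profile Liouville theorem WITHOUT a
lower bound (the open Chae–Shvydkoy endpoint) is untouched: decay never yields triviality.
-/

noncomputable section

-- flat `Theorems/<Route><Decl>…` files of one crux share the namespace of the crux (tree convention)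
set_option linter.dupNamespace false

open MeasureTheory Set Filter Topology Metric Function Finset
open scoped ENNReal NNReal InnerProductSpace RealInnerProductSpace

namespace Summit.NavierStokesRegularity.NavierStokesRegularity.Theorems.PowerGaugeEulerLiouville

open Literature.Analysis Literature.Analysis.FluidPDE

section Liouville

variable {V : EuclideanSpace ℝ (Fin 3) → EuclideanSpace ℝ (Fin 3)} {P : EuclideanSpace ℝ (Fin 3) → ℝ}

/-- **A lower power bound forces a lower shell-energy bound:** if `‖V(y)‖ ≥ c |y|^{−(4−δ')}`
a.e. on `|y| ≥ R₀'` (`c > 0`, `δ' ≤ 4`) and `‖V‖² ∈ L¹`, then for `L ≥ max R₀' 1`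
`(c² 2^{−(8−2δ')} 4^{−3} vol B₁) · L^{−5+2δ'} ≤ ∫_{L ≤ |y| < 2L} ‖V‖²` (the closed ball of radius
`L/4` about a point of norm `3L/2` lies in the shell). [cite: ChaeShvydkoy2013, §3.1 proof of Thm. 3.1 (contradiction with the lower bound of (3.1))] -/
theorem shell_energy_lower_of_powerLower (hV2 : Integrable (fun z => ‖V z‖ ^ 2) volume)
    {c δ' R₀' : ℝ} (hc : 0 < c) (hδ'4 : δ' ≤ 4)
    (hlow : ∀ᵐ y ∂volume, R₀' ≤ ‖y‖ → c * ‖y‖ ^ (-(4 - δ')) ≤ ‖V y‖) {L : ℝ}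
    (hL : max R₀' 1 ≤ L) :
    c ^ 2 * (2 : ℝ) ^ (-(8 - 2 * δ')) * (1 / 4) ^ 3 *
        volume.real (ball (0 : EuclideanSpace ℝ (Fin 3)) 1) * L ^ (-(5 : ℝ) + 2 * δ') ≤
      ∫ y in {y | L ≤ ‖y‖ ∧ ‖y‖ < 2 * L}, ‖V y‖ ^ 2 := by
  have hL1 : 1 ≤ L := (le_max_right _ _).trans hL
  have hL0 : 0 < L := one_pos.trans_le hL1
  have hR : R₀' ≤ L := (le_max_left _ _).trans hL
  -- the point `y₀` of norm `3L/2` and the ball `B̄(y₀, L/4) ⊆ shell`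
  obtain ⟨y₀, hy₀n⟩ := exists_norm_eq (EuclideanSpace ℝ (Fin 3)) (by positivity : (0 : ℝ) ≤ 3 * L / 2)
  set B : Set (EuclideanSpace ℝ (Fin 3)) := closedBall y₀ (L / 4) with hB
  have hBsub : B ⊆ {y | L ≤ ‖y‖ ∧ ‖y‖ < 2 * L} := by
    intro y hy
    rw [hB, mem_closedBall, dist_eq_norm] at hy
    have h1 : ‖y₀‖ - ‖y - y₀‖ ≤ ‖y‖ := by
      have := norm_sub_norm_le y₀ (y₀ - y)
      rw [sub_sub_cancel, norm_sub_rev] at this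
      linarith
    have h2 : ‖y‖ ≤ ‖y - y₀‖ + ‖y₀‖ := by
      have := norm_add_le (y - y₀) y₀
      rwa [sub_add_cancel] at this
    constructor <;> linarith
  -- pointwise lower bound on `B`: `‖V y‖² ≥ m²`, `m = c (2L)^{−(4−δ')}`
  set m : ℝ := c * (2 * L) ^ (-(4 - δ')) with hm
  have hm0 : 0 ≤ m := by positivity
  have hptB : ∀ᵐ y ∂volume, y ∈ B → m ^ 2 ≤ ‖V y‖ ^ 2 := by
    filter_upwards [hlow] with y hy hyB
    have hys := hBsub hyB
    have hyR : R₀' ≤ ‖y‖ := hR.trans hys.1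
    have hy0 : 0 < ‖y‖ := hL0.trans_le hys.1
    have h1 : m ≤ c * ‖y‖ ^ (-(4 - δ')) := by
      rw [hm]
      refine mul_le_mul_of_nonneg_left ?_ hc.le
      exact Real.rpow_le_rpow_of_nonpos hy0 hys.2.le (by linarith)
    exact pow_le_pow_left₀ hm0 (h1.trans (hy hyR)) 2
  -- integrate over `B ⊆ shell`
  have hBm : MeasurableSet B := measurableSet_closedBall
  have hvolB : volume.real B = (L / 4) ^ 3 * volume.real (ball (0 : EuclideanSpace ℝ (Fin 3)) 1) := by
    rw [hB, Measure.addHaar_real_closedBall _ _ (by positivity), finrank_euclideanSpace_fin]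
  have hμB : volume B ≠ ⊤ := measure_closedBall_lt_top.ne
  haveI : IsFiniteMeasure (volume.restrict B) := isFiniteMeasure_restrict.2 hμB
  have hI1 : ∫ y in B, m ^ 2 ≤ ∫ y in B, ‖V y‖ ^ 2 :=
    setIntegral_mono_on_ae (integrable_const _) hV2.integrableOn hBm hptB
  have hI2 : ∫ y in B, ‖V y‖ ^ 2 ≤ ∫ y in {y | L ≤ ‖y‖ ∧ ‖y‖ < 2 * L}, ‖V y‖ ^ 2 :=
    setIntegral_mono_set hV2.integrableOn (Eventually.of_forall fun y => by positivity)
      (Eventually.of_forall hBsub)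
  rw [setIntegral_const, smul_eq_mul, hvolB] at hI1
  refine le_trans (le_of_eq ?_) (hI1.trans hI2)
  -- exponent bookkeeping: `m² (L/4)³ v = c² 2^{−(8−2δ')} (1/4)³ v L^{−5+2δ'}`
  have hm2 : m ^ 2 = c ^ 2 * ((2 : ℝ) ^ (-(8 - 2 * δ')) * L ^ (-(8 - 2 * δ'))) := by
    rw [hm, mul_pow, ← Real.rpow_natCast ((2 * L) ^ (-(4 - δ'))) 2,
      ← Real.rpow_mul (by positivity), Real.mul_rpow (by norm_num) hL0.le]
    norm_num
    left; ring_nf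
  have hL3 : (L / 4) ^ 3 = (1 / 4) ^ 3 * L ^ (3 : ℝ) := by
    rw [show (3 : ℝ) = ((3 : ℕ) : ℝ) by norm_num, Real.rpow_natCast]; ring
  rw [hm2]
  have hLpow : L ^ (-(8 - 2 * δ')) * L ^ (3 : ℝ) = L ^ (-(5 : ℝ) + 2 * δ') := by
    rw [← Real.rpow_add hL0]; ring_nf
  calc c ^ 2 * (2 : ℝ) ^ (-(8 - 2 * δ')) * (1 / 4) ^ 3 *
        volume.real (ball (0 : EuclideanSpace ℝ (Fin 3)) 1) * L ^ (-(5 : ℝ) + 2 * δ')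
      = c ^ 2 * (2 : ℝ) ^ (-(8 - 2 * δ')) * (1 / 4) ^ 3 *
        volume.real (ball (0 : EuclideanSpace ℝ (Fin 3)) 1) * (L ^ (-(8 - 2 * δ')) * L ^ (3 : ℝ)) := by
          rw [hLpow]
    _ = (L / 4) ^ 3 * volume.real (ball (0 : EuclideanSpace ℝ (Fin 3)) 1) *
        (c ^ 2 * ((2 : ℝ) ^ (-(8 - 2 * δ')) * L ^ (-(8 - 2 * δ')))) := by
          rw [hL3]; ring

/-- **Chae–Shvydkoy's Theorem 3.1 in the weak (profile) class.**  Under the hypotheses of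
`shell_energy_decay_half` (profile pair `(V, P)`, `V ∈ L² ∩ L³_loc`, `|P||V| ∈ L¹_loc`, forward
profile LEI at `γ = 2/5`, Riesz representation of `P`, sublinear growth
`‖V(y)‖ ≤ C_up|y|^{1−δ}`), the LOWER power bound `‖V(y)‖ ≥ c |y|^{−(4−δ')}` a.e. on
`|y| ≥ R₀'` (`c, δ' > 0`) is contradictory: no energy-conserving self-similar Euler profile has
the power spread `c|y|^{−(N+1−δ)} ≤ |v(y)| ≤ C|y|^{1−δ}` (here with independent `δ, δ'`, in
Seregin's suitable weak class rather than `C¹_loc`, and with the lower bound used only at the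
end). [cite: ChaeShvydkoy2013, §3.1 Thm. 3.1] -/
theorem profile_liouville_half_of_powerSpread
    (hVm : AEStronglyMeasurable V volume) (hV2 : Integrable (fun z => ‖V z‖ ^ 2) volume)
    (hV3 : LocallyIntegrable (fun y => ‖V y‖ ^ 3) volume)
    (hPV : LocallyIntegrable (fun y => |P y| * ‖V y‖) volume)
    {γ : ℝ} (hγ : γ = 2 / 5)
    (hLEI : ∀ σ : EuclideanSpace ℝ (Fin 3) → ℝ, ContDiff ℝ (⊤ : ℕ∞) σ → HasCompactSupport σ →
      (∀ x, 0 ≤ σ x) →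
      ∀ᵐ τ₁ : ℝ, τ₁ < 0 → ∀ᵐ τ₂ : ℝ, τ₂ ∈ Ioo τ₁ 0 →
        (-τ₂) ^ (5 * γ - 2) * ∫ y, ‖V y‖ ^ 2 * σ ((-τ₂) ^ γ • y) ≤
          ((-τ₁) ^ (5 * γ - 2) * ∫ y, ‖V y‖ ^ 2 * σ ((-τ₁) ^ γ • y)) +
            ∫ τ in Ico τ₁ τ₂, (-τ) ^ (6 * γ - 3) *
              ∫ y, (‖V y‖ ^ 2 + 2 * P y) * ⟪V y, gradient σ ((-τ) ^ γ • y)⟫)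
    {R₁ : ℝ}
    (hP : ∀ R : ℝ, R₁ ≤ R → ∀ᵐ y ∂volume, ‖y‖ < R / 2 →
      P y = rieszPressure ((ball (0 : EuclideanSpace ℝ (Fin 3)) R).indicator V) y +
        ∫ z in {z | R ≤ ‖z‖}, pressureKernel (y - z) (V z))
    {δ Cup R₀ : ℝ} (hδ : 0 < δ) (hδ1 : δ ≤ 1) (hCup : 0 ≤ Cup)
    (hup : ∀ᵐ y ∂volume, R₀ ≤ ‖y‖ → ‖V y‖ ≤ Cup * ‖y‖ ^ (1 - δ))
    {c δ' R₀' : ℝ} (hc : 0 < c) (hδ' : 0 < δ')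
    (hlow : ∀ᵐ y ∂volume, R₀' ≤ ‖y‖ → c * ‖y‖ ^ (-(4 - δ')) ≤ ‖V y‖) : False := by
  -- WLOG `δ' ≤ 4` (a larger `δ'` gives a stronger bound on `|y| ≥ 1`)
  set δ₀ : ℝ := min δ' 4 with hδ₀
  have hδ₀0 : 0 < δ₀ := lt_min hδ' (by norm_num)
  have hδ₀4 : δ₀ ≤ 4 := min_le_right _ _
  have hlow' : ∀ᵐ y ∂volume, max R₀' 1 ≤ ‖y‖ → c * ‖y‖ ^ (-(4 - δ₀)) ≤ ‖V y‖ := by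
    filter_upwards [hlow] with y hy hyR
    have hy1 : 1 ≤ ‖y‖ := (le_max_right _ _).trans hyR
    refine le_trans (mul_le_mul_of_nonneg_left ?_ hc.le) (hy ((le_max_left _ _).trans hyR))
    exact Real.rpow_le_rpow_of_exponent_le hy1 (by linarith [min_le_left δ' 4])
  -- decay with `ε = δ₀` against the lower bound with `2δ₀`
  obtain ⟨C, hC⟩ := shell_energy_decay_half hVm hV2 hV3 hPV hγ hLEI hP hδ hδ1 hCup hup hδ₀0
  set c₀ : ℝ := c ^ 2 * (2 : ℝ) ^ (-(8 - 2 * δ₀)) * (1 / 4) ^ 3 *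
    volume.real (ball (0 : EuclideanSpace ℝ (Fin 3)) 1) with hc₀
  have hv : 0 < volume.real (ball (0 : EuclideanSpace ℝ (Fin 3)) 1) :=
    ENNReal.toReal_pos (measure_ball_pos _ _ one_pos).ne' measure_ball_lt_top.ne
  have hc₀0 : 0 < c₀ := by positivity
  have hkey : ∀ L, max (max R₀' 1) 1 ≤ L → c₀ * L ^ δ₀ ≤ C := by
    intro L hL
    have hL1 : 1 ≤ L := (le_max_right _ _).trans hL
    have hL0 : 0 < L := one_pos.trans_le hL1
    have h1 : c₀ * L ^ (-(5 : ℝ) + 2 * δ₀) ≤ C * L ^ (-(5 : ℝ) + δ₀) := by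
      rw [hc₀]; exact (shell_energy_lower_of_powerLower hV2 hc hδ₀4 hlow' hL).trans (hC L hL1)
    have h2 : c₀ * L ^ (-(5 : ℝ) + 2 * δ₀) * L ^ (5 - δ₀) ≤ C * L ^ (-(5 : ℝ) + δ₀) * L ^ (5 - δ₀) :=
      mul_le_mul_of_nonneg_right h1 (Real.rpow_pos_of_pos hL0 _).le
    have e1 : c₀ * L ^ (-(5 : ℝ) + 2 * δ₀) * L ^ (5 - δ₀) = c₀ * L ^ δ₀ := by
      rw [mul_assoc, ← Real.rpow_add hL0, show -(5 : ℝ) + 2 * δ₀ + (5 - δ₀) = δ₀ by ring]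
    have e2 : C * L ^ (-(5 : ℝ) + δ₀) * L ^ (5 - δ₀) = C := by
      rw [mul_assoc, ← Real.rpow_add hL0, show -(5 : ℝ) + δ₀ + (5 - δ₀) = 0 by ring,
        Real.rpow_zero, mul_one]
    rw [e1, e2] at h2
    exact h2
  have hev : ∀ᶠ L : ℝ in atTop, C / c₀ < L ^ δ₀ ∧ max (max R₀' 1) 1 ≤ L :=
    ((tendsto_rpow_atTop hδ₀0).eventually_gt_atTop (C / c₀)).and (eventually_ge_atTop _)
  obtain ⟨L, hL1, hL2⟩ := hev.exists
  have := hkey L hL2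
  rw [div_lt_iff₀ hc₀0] at hL1
  linarith [mul_comm c₀ (L ^ δ₀)]

end Liouville

end Summit.NavierStokesRegularity.NavierStokesRegularity.Theorems.PowerGaugeEulerLiouville
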